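import Mathlib
import Literature.Computability.AlgebraicComplexity.BirkhoffShadowProofs

/-!
# `NewtonUnitEquationsNewtonTauWeakAxialShadow` — axial 3-assignment shadows have at most `2^{6m}` uniquely supported points per pencil

Line `binomial-normal-form` of crux `NewtonTauWeak` (stmt-ValiantsHypothesis-5904), lead c7, stub P16.
An AXIAL 3-ASSIGNMENT on columns `C`, rows `R`, pillars `P` is a pair of bijections
`(e₁ : C ≃ R, e₂ : C ≃ P)`; with planar weights `w r p x` its point is `Σ_x w (e₁ x) (e₂ x) x`.
For every pencil of additive functionals `c + t • d` the cloud of all axial assignments has at most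
`2^{6 #C}` points that are the unique maximiser of some member of the pencil.

Proof = the halving recursion of Hrubeš–Yehudayoff (2021, Prop. 23, `σ(DS_{2n}) ≤ 2·C(2n,n)·σ(DS_n)`),
run with PAIRS of bijections, reusing the pencil toolkit of
`Literature.Computability.AlgebraicComplexity.HrubesYehudayoff2021Prop23` (file
`BirkhoffShadowProofs.lean`): splitting the columns at `C₁` (`#C₁ = ⌊m/2⌋`), the cloud is the union
over `(S, T) ∈ Finset R × Finset P` of the Minkowski sums of the two half-size clouds
(`axialSums_eq_iUnion`), whence `f(m) ≤ 4^m (f ⌊m/2⌋ + f ⌈m/2⌉)` (`ncard_um_axialSums_step`);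
with the trivial bound `f(m) ≤ (m!)² ≤ 2^{6m}` for `m ≤ 3` and `2m + 1 + 6⌈m/2⌉ ≤ 6m` for `m ≥ 4`
this gives `f(m) ≤ 2^{6m}` (`ncard_um_axialSums_le`).

`stub_axialShadow` is the registered stub text, verbatim.  Folklore-level; Mathlib and the sorry-free
tree file `BirkhoffShadowProofs.lean` only; no named facts, no `def`s.
-/

-- Sub = Summit single-conjunct layout: the duplicated namespace component is mandated by the tree.
set_option linter.dupNamespace false

noncomputable section

open scoped BigOperators

namespace Summit.ValiantsHypothesis.ValiantsHypothesis.Theorems.NewtonUnitEquationsNewtonTauWeak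

namespace AxialShadowAux

open scoped Pointwise
open Literature.Computability.AlgebraicComplexity.HrubesYehudayoff2021Prop23

/-- Gluing a bijection `C₁ ≃ S` with a bijection `C₁ᶜ ≃ Sᶜ` into a bijection of the ambient types
restricting to both (the `⊇` half of `permSums_eq_iUnion`). [folklore] -/
theorem exists_equiv_glue {α β : Type*} [DecidableEq α] [DecidableEq β] (C₁ : Finset α)
    (S : Finset β) (e₁ : {x // x ∈ C₁} ≃ {r // r ∈ S}) (e₂ : {x // x ∉ C₁} ≃ {r // r ∉ S}) :
    ∃ E : α ≃ β, (∀ x : {x // x ∈ C₁}, E x = e₁ x) ∧ ∀ x : {x // x ∉ C₁}, E x = e₂ x :=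
  ⟨(Equiv.sumCompl fun x => x ∈ C₁).symm.trans
      ((e₁.sumCongr e₂).trans (Equiv.sumCompl fun r => r ∈ S)),
    fun x => by simp, fun x => by simp⟩

variable {G : Type*} [AddCommGroup G] (c d : G →+ ℝ)

/-- `V = ⋃_{(S,T)} V_{S,T}`: splitting the columns at `C₁`, a pair of bijections
`(C ≃ R, C ≃ P)` is a pair of pairs `(C₁ ≃ S, C₁ ≃ T)`, `(C₁ᶜ ≃ Sᶜ, C₁ᶜ ≃ Tᶜ)` with `S`, `T` the
images of `C₁`, and the axial sum splits as a sum of the two half sums (pairs-of-bijections form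
of `permSums_eq_iUnion`). [folklore] -/
theorem axialSums_eq_iUnion {R P C : Type} [Fintype C] [DecidableEq R] [DecidableEq P]
    [DecidableEq C] (w : R → P → C → G) (C₁ : Finset C) :
    Set.range (fun e : (C ≃ R) × (C ≃ P) => ∑ x, w (e.1 x) (e.2 x) x) =
      ⋃ ST : Finset R × Finset P,
        (Set.range (fun e : ({x // x ∈ C₁} ≃ {r // r ∈ ST.1}) × ({x // x ∈ C₁} ≃ {p // p ∈ ST.2}) =>
            ∑ x, w (e.1 x) (e.2 x) x) +
          Set.range (fun e : ({x // x ∉ C₁} ≃ {r // r ∉ ST.1}) × ({x // x ∉ C₁} ≃ {p // p ∉ ST.2}) =>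
            ∑ x, w (e.1 x) (e.2 x) x)) := by
  ext q
  simp only [Set.mem_range, Set.mem_iUnion, Set.mem_add, Prod.exists]
  constructor
  · rintro ⟨e₁, e₂, rfl⟩
    refine ⟨C₁.map e₁.toEmbedding, C₁.map e₂.toEmbedding, _,
      ⟨e₁.subtypeEquiv fun x => (Finset.mem_map' e₁.toEmbedding).symm,
        e₂.subtypeEquiv fun x => (Finset.mem_map' e₂.toEmbedding).symm, rfl⟩, _,
      ⟨e₁.subtypeEquiv fun x => (Finset.mem_map' e₁.toEmbedding).not.symm,
        e₂.subtypeEquiv fun x => (Finset.mem_map' e₂.toEmbedding).not.symm, rfl⟩, ?_⟩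
    exact sum_mem_add_sum_not_mem C₁ (fun x => w (e₁ x) (e₂ x) x)
  · rintro ⟨S, T, _, ⟨e₁, f₁, rfl⟩, _, ⟨e₂, f₂, rfl⟩, rfl⟩
    obtain ⟨E, hE₁, hE₂⟩ := exists_equiv_glue C₁ S e₁ e₂
    obtain ⟨F, hF₁, hF₂⟩ := exists_equiv_glue C₁ T f₁ f₂
    refine ⟨E, F, ?_⟩
    rw [← sum_mem_add_sum_not_mem C₁ (fun x => w (E x) (F x) x)]
    simp only [hE₁, hE₂, hF₁, hF₂]

/-- One step of the recursion: `f(V) ≤ 2^{#R} · 2^{#P} · (B₁ + B₂)` if the two families of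
half-size axial sums are bounded by `B₁`, `B₂` (union bound over `(S, T)`, Minkowski bound
`ncard_um_add_le` per index). [folklore] -/
theorem ncard_um_axialSums_step {R P C : Type} [Fintype R] [Fintype P] [Fintype C]
    [DecidableEq R] [DecidableEq P] [DecidableEq C] (w : R → P → C → G) (C₁ : Finset C)
    (B₁ B₂ : ℕ)
    (h₁ : ∀ (S : Finset R) (T : Finset P),
      {p | p ∈ Set.range (fun e : ({x // x ∈ C₁} ≃ {r // r ∈ S}) × ({x // x ∈ C₁} ≃ {p // p ∈ T}) =>
          ∑ x, w (e.1 x) (e.2 x) x) ∧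
        ∃ t : ℝ, ∀ q ∈ Set.range (fun e : ({x // x ∈ C₁} ≃ {r // r ∈ S}) ×
          ({x // x ∈ C₁} ≃ {p // p ∈ T}) => ∑ x, w (e.1 x) (e.2 x) x), q ≠ p →
            c q + t * d q < c p + t * d p}.ncard ≤ B₁)
    (h₂ : ∀ (S : Finset R) (T : Finset P),
      {p | p ∈ Set.range (fun e : ({x // x ∉ C₁} ≃ {r // r ∉ S}) × ({x // x ∉ C₁} ≃ {p // p ∉ T}) =>
          ∑ x, w (e.1 x) (e.2 x) x) ∧
        ∃ t : ℝ, ∀ q ∈ Set.range (fun e : ({x // x ∉ C₁} ≃ {r // r ∉ S}) ×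
          ({x // x ∉ C₁} ≃ {p // p ∉ T}) => ∑ x, w (e.1 x) (e.2 x) x), q ≠ p →
            c q + t * d q < c p + t * d p}.ncard ≤ B₂) :
    {p | p ∈ Set.range (fun e : (C ≃ R) × (C ≃ P) => ∑ x, w (e.1 x) (e.2 x) x) ∧
      ∃ t : ℝ, ∀ q ∈ Set.range (fun e : (C ≃ R) × (C ≃ P) => ∑ x, w (e.1 x) (e.2 x) x), q ≠ p →
        c q + t * d q < c p + t * d p}.ncard ≤
      2 ^ Fintype.card R * 2 ^ Fintype.card P * (B₁ + B₂) := by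
  rw [axialSums_eq_iUnion w C₁]
  refine (ncard_um_iUnion_le c d _ fun ST => (Set.finite_range _).add (Set.finite_range _)).trans ?_
  refine (Finset.sum_le_sum (g := fun _ => B₁ + B₂) fun ST _ => ?_).trans ?_
  · -- the two half bounds are instantiated first (as `have`s), then the Minkowski step is applied
    have H₁ := h₁ ST.1 ST.2
    have H₂ := h₂ ST.1 ST.2
    refine (ncard_um_add_le c d _ _ (Set.finite_range _) (Set.finite_range _)).trans ?_
    exact add_le_add H₁ H₂
  · rw [Finset.sum_const, Finset.card_univ, Fintype.card_prod, Fintype.card_finset,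
      Fintype.card_finset, smul_eq_mul]

/-- **Counting form**: for every pencil, the axial sums `{∑_x w (e₁ x) (e₂ x) x : (e₁, e₂)}` have at
most `2^{6 #C}` uniquely supported points (recursion `f(m) ≤ 4^m (f ⌊m/2⌋ + f ⌈m/2⌉)` for
`m ≥ 4`, `f(m) ≤ (m!)²` for `m ≤ 3`). [folklore] -/
theorem ncard_um_axialSums_le (m : ℕ) :
    ∀ (R P C : Type) [Fintype R] [Fintype P] [Fintype C] [DecidableEq R] [DecidableEq P]
      [DecidableEq C], Fintype.card C = m → ∀ w : R → P → C → G,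
        {p | p ∈ Set.range (fun e : (C ≃ R) × (C ≃ P) => ∑ x, w (e.1 x) (e.2 x) x) ∧
          ∃ t : ℝ, ∀ q ∈ Set.range (fun e : (C ≃ R) × (C ≃ P) => ∑ x, w (e.1 x) (e.2 x) x),
            q ≠ p → c q + t * d q < c p + t * d p}.ncard ≤ 2 ^ (6 * m) := by
  induction m using Nat.strong_induction_on with
  | _ m ih =>
  intro R P C _ _ _ _ _ _ hCm w
  rcases ne_or_eq (Fintype.card R) (Fintype.card C) with hRC | hRC
  · have hempty : Set.range (fun e : (C ≃ R) × (C ≃ P) => ∑ x, w (e.1 x) (e.2 x) x) = ∅ :=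
      Set.range_eq_empty_iff.2 ⟨fun e => hRC (Fintype.card_congr e.1).symm⟩
    rw [hempty]
    simp
  rcases ne_or_eq (Fintype.card P) (Fintype.card C) with hPC | hPC
  · have hempty : Set.range (fun e : (C ≃ R) × (C ≃ P) => ∑ x, w (e.1 x) (e.2 x) x) = ∅ :=
      Set.range_eq_empty_iff.2 ⟨fun e => hPC (Fintype.card_congr e.2).symm⟩
    rw [hempty]
    simp
  have hfin : (Set.range (fun e : (C ≃ R) × (C ≃ P) => ∑ x, w (e.1 x) (e.2 x) x)).Finite :=
    Set.finite_range _
  rcases Nat.lt_or_ge 3 m with hm | hm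
  swap
  · -- `m ≤ 3`: the range has at most `#((C ≃ R) × (C ≃ P)) = (m!)² ≤ 2^{6m}` points.
    have e₁ : C ≃ R := Fintype.equivOfCardEq hRC.symm
    have e₂ : C ≃ P := Fintype.equivOfCardEq hPC.symm
    refine (Set.ncard_le_ncard (um_subset c d _) hfin).trans ?_
    rw [← Set.image_univ]
    refine (Set.ncard_image_le Set.finite_univ).trans ?_
    rw [Set.ncard_univ, Nat.card_eq_fintype_card, Fintype.card_prod, Fintype.card_equiv e₁,
      Fintype.card_equiv e₂, hCm]
    interval_cases m <;> decide
  -- `m ≥ 4`: halve the columns.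
  obtain ⟨C₁, -, hC₁⟩ := Finset.exists_subset_card_eq (s := (Finset.univ : Finset C))
    (n := m / 2) (by rw [Finset.card_univ, hCm]; omega)
  have hc1 : Fintype.card {x // x ∈ C₁} = m / 2 := by rw [Fintype.card_coe, hC₁]
  have hc2 : Fintype.card {x // x ∉ C₁} = m - m / 2 := by
    rw [Fintype.card_subtype_compl, Fintype.card_coe, hC₁, hCm]
  refine (ncard_um_axialSums_step c d w C₁ (2 ^ (6 * (m / 2))) (2 ^ (6 * (m - m / 2)))
    (fun S T => ih (m / 2) (by omega) {r // r ∈ S} {p // p ∈ T} {x // x ∈ C₁} hc1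
      fun r p x => w r p x)
    (fun S T => ih (m - m / 2) (by omega) {r // r ∉ S} {p // p ∉ T} {x // x ∉ C₁} hc2
      fun r p x => w r p x)).trans ?_
  rw [hRC, hPC, hCm]
  have h1 : 2 ^ (6 * (m / 2)) ≤ 2 ^ (6 * (m - m / 2)) :=
    Nat.pow_le_pow_right (by norm_num) (by omega)
  have h2 : m + m + 1 + 6 * (m - m / 2) ≤ 6 * m := by omega
  calc 2 ^ m * 2 ^ m * (2 ^ (6 * (m / 2)) + 2 ^ (6 * (m - m / 2)))
      ≤ 2 ^ m * 2 ^ m * (2 * 2 ^ (6 * (m - m / 2))) := Nat.mul_le_mul_left _ (by omega)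
    _ = 2 ^ (m + m + 1 + 6 * (m - m / 2)) := by rw [pow_add, pow_add, pow_add, pow_one]; ring
    _ ≤ 2 ^ (6 * m) := Nat.pow_le_pow_right (by norm_num) h2

end AxialShadowAux

/-- STUB P16 — **axial 3-assignment shadows.**  For columns `C` (`#C = m`), rows `R`, pillars `P`
and planar weights `w : R → P → C → ℝ²`, the cloud of all axial assignments
`{Σ_x w (e₁ x) (e₂ x) x : (e₁, e₂) : (C ≃ R) × (C ≃ P)}` has at most `2^{6m}` points that are the
unique maximiser of a member of the pencil `c + t • d`, for every pair of additive functionals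
`c, d` (the 3-partite case of the bounded-block count; "axial assignments halve like matchings").
[folklore] -/
theorem stub_axialShadow (m : ℕ) :
    ∀ (R P C : Type) [Fintype R] [Fintype P] [Fintype C] [DecidableEq R] [DecidableEq P] [DecidableEq C],
      Fintype.card C = m → ∀ (c d : (Fin 2 → ℝ) →+ ℝ) (w : R → P → C → (Fin 2 → ℝ)),
        {p : Fin 2 → ℝ | p ∈ Set.range (fun e : (C ≃ R) × (C ≃ P) => ∑ x, w (e.1 x) (e.2 x) x) ∧
          ∃ t : ℝ, ∀ q ∈ Set.range (fun e : (C ≃ R) × (C ≃ P) => ∑ x, w (e.1 x) (e.2 x) x), q ≠ p →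
            c q + t * d q < c p + t * d p}.ncard ≤ 2 ^ (6 * m) := by
  intro R P C _ _ _ _ _ _ hC c d w
  exact AxialShadowAux.ncard_um_axialSums_le c d m R P C hC w

end Summit.ValiantsHypothesis.ValiantsHypothesis.Theorems.NewtonUnitEquationsNewtonTauWeak

end
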